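import Summits.QuantumFields.YangMills.Theorems.BalabanUVNodesN21ThresholdMixtureRepr
import Summits.QuantumFields.YangMills.Theorems.BalabanUVNodesN21AtSpineCarriersProfiledRealized

/-!
# YM-DAG node N21 (= NE7c) AT THE SPINE CARRIERS, THRESHOLD-MIXTURE READING: the K5 stub `YMDAG.UVSplit.S_N21 SRec` for every carrier
# predicate whose two runs are λ-AVERAGES OF THRESHOLD-FREE SHARP REPRESENTATIONS — design (η)'s realized knit `n21_knit_repr` (file 2) FIRES
# on the EXISTING sharp record through `termRepr_of_sharpMixture` (file 5b), with NO profiled tower of record; and the vacuity guard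
# (pv07's §5 toy IS a sharp mixture)

Track A of `YM-PLAN.md` (cell `pub-ymgap`, HUMAN RULING D-0062), node **N21**; R141 (C) fan-out seat `pub-ymgap-dag-n21-e` (s3 = ALTERNATIVE
CURRENCY), generation 2, file 6 = ROW A (γ) of the lens memo `ym-lens-BalabanUVNodes-nearmiss/LENS-nearmiss.md` v2.0 §4 (pub-ymgap INBOX
l.13275; dag-lead GO after l.13562).  Companions: file 5a `…N21ThresholdMixture` (lens lemmas: profile = threshold average, (M1) for the mixture,
per-term product identity; transports), file 5b `…N21ThresholdMixtureRepr` (`termRepr_of_sharpMixture`), file 2 `…N21AtSpineCarriersProfiledRealized`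
(p454939: `n21_knit_repr`, `s_N21_of_reprReading`).  Kernel bookkeeping BY NAME: 0 `def`, 0 `sorry`, standard axioms.  COUNT-NEUTRAL; `--supports`
the K3′ item `SpineGivenEndpointR12` as a helper.

HONEST FRAMING.  NE7c is NOT PRINTED and NOT PROVED.  `S_N21 SRec` quantifies over the carriers OF RECORD that `SRec` pins (NODE 00 ∕ NODE O at
the Stage-12 record).  This file says what a record predicate must hand for N21 to follow on the MIXTURE road: per string and tuned run, common
per-term spaces with s-finite reference measures, the two runs' THRESHOLD-FREE SHARP representations `hXsA`∕`hXsB` (located input (O-mix-1),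
NODE O; the card's cheapest falsifier (K-ii): «is the threshold a free argument of `Node00.chiOfRecord`, read nowhere else?»), the carriers
`S.A`∕`S.B` PINNED as the normalised threshold averages, admissible widths `0 < κ_a < 1` (`T4LipschitzCutoff` §5∕§7), (F∞) `SupClose` (N16) and
`SiblingSuppression` of the realized siblings (N20, NE7b species) UNIFORM over the multipliers (O-mix-2), the shell parts PINNED as the realized
ones, and a summable record weight `S.Wsh` dominating the band weight.  NO anti-concentration hypothesis and NO profiled tower: (M1) for the
mixture is file 5a's Fubini theorem, and the profiles are λ-averages of print's sharp indicators.  Not print's construction verbatim (a convex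
combination of print's sharp procedure over admissible threshold vectors; ONE multiplier per OCCURRENCE, (O-mix-3)); N16 ∕ N20 untouched;
N21 NOT discharged; one finite four-torus programme at fixed `ε`; NOT continuum ∕ ℝ⁴ ∕ OS ∕ mass gap ∕ Clay.

CITATION HEADER (lean-in-tree rule 2026-08-18).  Everything BY NAME from the tree: file 5b `termRepr_of_sharpMixture`; file 2 `n21_knit_repr` ∕
`s_N21_of_reprReading`; file 5a `sharpMixture_prod_eq_profile_prod`; `T4LipschitzLedger` (`TermRepr`, `SupClose`, `sibW`, `shellW`, the §5 toy
`T4LipschitzLedger.Sanity`); `T4LipschitzCutoff` (`linProfile`, `SiblingSuppression`, `lipWeight`); `T4IndicatorShell.smallInd`;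
`…N21AtSpineCarriers.exists_family_and_datum` (p419285).  Context only (SHAPE): [Balaban1988Convergent] (2.17)∕(2.18) p. 257.

WHAT IS PROVED ([folklore]).  §1 `n21_knit_sharpMixture` — at EXPLICIT carriers: two threshold-free sharp representations + carriers pinned as
their normalised threshold averages + `SupClose` + `SiblingSuppression` ×2 + summable width + pinned shell parts ⇒ `ShellWeightBound l₀ T A B shA
shB Wsh` for every summable `Wsh` above the band weight `Σ_{a≤N} n_a·lipWeight (κ⁻¹) S ρ a K` (`termRepr_of_sharpMixture` ×2 ∘ `n21_knit_repr`).
§2 `s_N21_of_sharpMixtureReading` — the same at the K5 stub, ∃-closed over the auxiliary data exactly as file 2's `s_N21_of_reprReading`.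
§3 VACUITY GUARD (audit A1–A6): `toy_profiles_eq` (pv07's §5 toy profiles ARE `linProfile ∘ κ`, constants `κ⁻¹`), `toy_mixture_eq` (the
one-factor mixture identity `2·∫_{[1∕2,1]} 1[u < s] ds = linProfile (1∕2) u`), `toy_A_eq_mixture` ∕ `toy_B_eq_mixture` (the toy's two runs' weights
`1∕2`, `1∕2 − (1∕2)^K∕4` ARE the normalised threshold averages of the threshold-free sharp weights at `u^A = 3∕4`, `u^B = 3∕4 + (1∕2)^K∕8`, in the
letters of §2's package), `s_N21_fires_on_sharpMixtureReading` (the reading predicate of §2 is INHABITED by a bundle with nonempty classes, positive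
weights, positive run-A shell part and positive record weight, and `S_N21` holds on it).
-/

set_option autoImplicit false

noncomputable section

open scoped BigOperators
open MeasureTheory Set

namespace Summit.QuantumFields.YangMills.Theorems.N21AtSpineCarriersMixture

open Literature.MathematicalPhysics.QuantumFieldTheory.Balaban1983to89
open T4IndicatorShell (ShellWeightBound smallInd)
open T4LipschitzCutoff (linProfile SiblingSuppression lipWeight)
open T4LipschitzLedger (Pol TermRepr SupClose sibW shellW)
open YMDAG.UVSplit (SpineCarriers SpineRecordPred S_N21)
open N21ThresholdMixture (sharpMixture_prod_eq_profile_prod)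
open N21ThresholdMixtureRepr (termRepr_of_sharpMixture)
open N21AtSpineCarriersProfiledRealized (n21_knit_repr s_N21_of_reprReading)

/-! ## §1 Explicit carriers: the (η) knit FIRES on λ-averages of two threshold-free sharp representations -/

section Explicit

variable {ι : Type*} {Ω : ℕ → ι → Type*} [∀ K τ, MeasurableSpace (Ω K τ)]
  {l₀ : ℝ} {T : ℕ → Finset ι} {A B shA shB : ℕ → ℝ → ι → ℝ} {κ : ℕ → ℝ} {N : ℕ} {n : ℕ → ℕ}
  {μ : (K : ℕ) → (τ : ι) → Measure (Ω K τ)} [∀ K τ, SFinite (μ K τ)] {m : ℕ → ι → ℕ} {slot : ℕ → ι → ℕ → Σ _ : ℕ, ℕ}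
  {pol : ℕ → ι → ℕ → Pol} {θ : ℕ → ι → ℕ → ℝ} {uA uB : (K : ℕ) → (τ : ι) → ℕ → Ω K τ → ℝ}
  {RA RB : (K : ℕ) → ℝ → (τ : ι) → Ω K τ → ℝ} {ρ S : ℕ → ℝ}

/-- **N21 KNIT ON THE MIXTURE ROAD, EXPLICIT CARRIERS.**  Data of the two runs on COMMON per-term spaces `Ω K τ` with s-finite measures `μ K τ`:
factor data `(m, slot, pol, θ)` with `TermRepr`'s side conditions (`thr_pos`, `slot_mem`, `slot_band`, measurability of both runs' tested variables
`u^A`, `u^B`), nonnegative integrable THRESHOLD-FREE remainders `R^A`, `R^B`, admissible widths `0 < κ_a < 1`; (O-mix-1) the two runs' SHARP weights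
`Xs^A`, `Xs^B` as functions of a free threshold vector (`hXsA`, `hXsB`) and the carriers PINNED as their normalised threshold averages (`hA`, `hB`);
(O-mix-2) `SupClose … ρ` (N16) and `SiblingSuppression` of the realized siblings at the profiles `linProfile κ_a` in both runs (N20), `0 ≤ S`,
`0 ≤ ρ` summable; the shell parts PINNED as the realized ones.  THEN `ShellWeightBound l₀ T A B shA shB Wsh` for every summable `Wsh` dominating
`Σ_{a≤N} n_a·lipWeight (fun a => (κ a)⁻¹) S ρ a K` — file 5b's `termRepr_of_sharpMixture` (×2) fed to file 2's `n21_knit_repr` BY NAME.  NO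
anti-concentration, NO profiled tower.  CONDITIONAL on every displayed binder; NE7c NOT proved. [folklore] -/
theorem n21_knit_sharpMixture (XsA XsB : (K : ℕ) → ℝ → (τ : ι) → (Fin (m K τ) → ℝ) → ℝ) (hκ : ∀ a, 0 < κ a ∧ κ a < 1)
    (thr_pos : ∀ K, ∀ τ ∈ T K, ∀ i < m K τ, 0 < θ K τ i)
    (slot_mem : ∀ K, ∀ τ ∈ T K, ∀ i < m K τ, slot K τ i ∈ (Finset.range (N + 1)).sigma fun a => Finset.range (n a))
    (slot_band : ∀ K, ∀ τ ∈ T K, ∀ i < m K τ, (slot K τ i).1 ≤ K)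
    (meas : ∀ K, ∀ τ ∈ T K, ∀ i < m K τ, Measurable (uA K τ i) ∧ Measurable (uB K τ i))
    (remA_nonneg : ∀ K t, |t| ≤ l₀ → ∀ τ ∈ T K, 0 ≤ᵐ[μ K τ] RA K t τ)
    (remA_int : ∀ K t, |t| ≤ l₀ → ∀ τ ∈ T K, Integrable (RA K t τ) (μ K τ))
    (remB_nonneg : ∀ K t, |t| ≤ l₀ → ∀ τ ∈ T K, 0 ≤ᵐ[μ K τ] RB K t τ)
    (remB_int : ∀ K t, |t| ≤ l₀ → ∀ τ ∈ T K, Integrable (RB K t τ) (μ K τ))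
    (hXsA : ∀ K t, |t| ≤ l₀ → ∀ τ ∈ T K, ∀ s : Fin (m K τ) → ℝ,
      XsA K t τ s = ∫ v, (∏ i : Fin (m K τ), (pol K τ i).fac (smallInd (uA K τ i v) (s i))) * RA K t τ v ∂(μ K τ))
    (hXsB : ∀ K t, |t| ≤ l₀ → ∀ τ ∈ T K, ∀ s : Fin (m K τ) → ℝ,
      XsB K t τ s = ∫ v, (∏ i : Fin (m K τ), (pol K τ i).fac (smallInd (uB K τ i v) (s i))) * RB K t τ v ∂(μ K τ))
    (hA : ∀ K t, |t| ≤ l₀ → ∀ τ ∈ T K, A K t τ =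
      (∏ i : Fin (m K τ), (κ (slot K τ i).1 * θ K τ i))⁻¹ *
        ∫ s, XsA K t τ s ∂(Measure.pi fun i : Fin (m K τ) =>
          volume.restrict (Icc ((1 - κ (slot K τ i).1) * θ K τ i) (θ K τ i))))
    (hB : ∀ K t, |t| ≤ l₀ → ∀ τ ∈ T K, B K t τ =
      (∏ i : Fin (m K τ), (κ (slot K τ i).1 * θ K τ i))⁻¹ *
        ∫ s, XsB K t τ s ∂(Measure.pi fun i : Fin (m K τ) =>
          volume.restrict (Icc ((1 - κ (slot K τ i).1) * θ K τ i) (θ K τ i))))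
    (hF : SupClose T μ m slot θ uA uB ρ)
    (hSA : SiblingSuppression l₀ T A N n (sibW (fun a => linProfile (κ a)) κ μ m slot pol θ uA RA ρ) S)
    (hSB : SiblingSuppression l₀ T B N n (sibW (fun a => linProfile (κ a)) κ μ m slot pol θ uB RB ρ) S)
    (hS : ∀ a ≤ N, 0 ≤ S a) (hρ0 : ∀ j, 0 ≤ ρ j) (hρ : Summable ρ)
    (hshA : shA = shellW (fun a => linProfile (κ a)) μ m slot pol θ uA uB RA)
    (hshB : shB = shellW (fun a => linProfile (κ a)) μ m slot pol θ uB uA RB)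
    {Wsh : ℕ → ℝ} (hWsh : ∀ K, ∑ a ∈ Finset.range (N + 1), (n a : ℝ) * lipWeight (fun a => (κ a)⁻¹) S ρ a K ≤ Wsh K)
    (hsum : Summable Wsh) : ShellWeightBound l₀ T A B shA shB Wsh :=
  n21_knit_repr (termRepr_of_sharpMixture XsA hκ thr_pos slot_mem slot_band meas remA_nonneg remA_int hXsA hA)
    (termRepr_of_sharpMixture XsB hκ thr_pos slot_mem slot_band (fun K τ hτ i hi => (meas K τ hτ i hi).symm) remB_nonneg
      remB_int hXsB hB)
    hF hSA hSB hS hρ0 hρ hshA hshB hWsh hsum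

end Explicit

/-! ## §2 At the spine carriers: `S_N21 SRec` for every threshold-mixture reading -/

section AtCarriers

variable {N : ℕ} [NeZero N]

/-- **`S_N21` FOR EVERY THRESHOLD-MIXTURE READING.**  If the carrier predicate `SRec` hands, with every bundle `S` it pins, per-term measurable
spaces `Ω K τ` with s-finite measures `μ K τ`, admissible widths `κ` (`0 < κ_a < 1`), a window `Nw` with counts `n`, factor data
`(m, slot, pol, θ)` with `TermRepr`'s side conditions, the two runs' measurable tested variables `u^A, u^B`, nonnegative integrable threshold-free
remainders `R^A, R^B`, the two runs' SHARP weights `Xs^A, Xs^B` as functions of a free threshold vector (O-mix-1) with `S.A`, `S.B` PINNED as their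
normalised threshold averages over `⊗_i Leb|[(1 − κ_{a_i})θ_i, θ_i]`, a width `ρ ≥ 0` summable with `SupClose … ρ` (N16), `SiblingSuppression` of the
realized siblings at the profiles `linProfile κ_a` in both runs with constants `Ssup ≥ 0` (N20), the shell parts PINNED as the realized ones, and
`S.Wsh` summable dominating the band weight — then `S_N21 SRec` (§1).  NO anti-concentration, NO profiled tower. [folklore] -/
theorem s_N21_of_sharpMixtureReading (SRec : SpineRecordPred N)
    (hread : ∀ (F : T4Continuum.T4Family) (D : YMDAG.UVSplit.Datum F N) (g₀ : ℕ → ℝ)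
      (os : List (T4Continuum.ULoop F)) (S : SpineCarriers), SRec F D g₀ os S →
      ∃ (Ω : ℕ → S.ι → Type) (_mΩ : ∀ K τ, MeasurableSpace (Ω K τ)) (μ : (K : ℕ) → (τ : S.ι) → Measure (Ω K τ))
        (_sf : ∀ K τ, SFinite (μ K τ)) (κ : ℕ → ℝ) (Nw : ℕ) (n : ℕ → ℕ) (m : ℕ → S.ι → ℕ) (slot : ℕ → S.ι → ℕ → Σ _ : ℕ, ℕ)
        (pol : ℕ → S.ι → ℕ → Pol) (θ : ℕ → S.ι → ℕ → ℝ) (uA uB : (K : ℕ) → (τ : S.ι) → ℕ → Ω K τ → ℝ)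
        (RA RB : (K : ℕ) → ℝ → (τ : S.ι) → Ω K τ → ℝ) (XsA XsB : (K : ℕ) → ℝ → (τ : S.ι) → (Fin (m K τ) → ℝ) → ℝ)
        (ρ Ssup : ℕ → ℝ),
        (∀ a, 0 < κ a ∧ κ a < 1) ∧
        (∀ K, ∀ τ ∈ S.T K, ∀ i < m K τ, 0 < θ K τ i) ∧
        (∀ K, ∀ τ ∈ S.T K, ∀ i < m K τ, slot K τ i ∈ (Finset.range (Nw + 1)).sigma fun a => Finset.range (n a)) ∧
        (∀ K, ∀ τ ∈ S.T K, ∀ i < m K τ, (slot K τ i).1 ≤ K) ∧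
        (∀ K, ∀ τ ∈ S.T K, ∀ i < m K τ, Measurable (uA K τ i) ∧ Measurable (uB K τ i)) ∧
        (∀ K t, |t| ≤ S.l₀ → ∀ τ ∈ S.T K, 0 ≤ᵐ[μ K τ] RA K t τ) ∧
        (∀ K t, |t| ≤ S.l₀ → ∀ τ ∈ S.T K, Integrable (RA K t τ) (μ K τ)) ∧
        (∀ K t, |t| ≤ S.l₀ → ∀ τ ∈ S.T K, 0 ≤ᵐ[μ K τ] RB K t τ) ∧
        (∀ K t, |t| ≤ S.l₀ → ∀ τ ∈ S.T K, Integrable (RB K t τ) (μ K τ)) ∧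
        -- (O-mix-1) the two runs' threshold-free SHARP representations
        (∀ K t, |t| ≤ S.l₀ → ∀ τ ∈ S.T K, ∀ s : Fin (m K τ) → ℝ,
          XsA K t τ s = ∫ v, (∏ i : Fin (m K τ), (pol K τ i).fac (smallInd (uA K τ i v) (s i))) * RA K t τ v ∂(μ K τ)) ∧
        (∀ K t, |t| ≤ S.l₀ → ∀ τ ∈ S.T K, ∀ s : Fin (m K τ) → ℝ,
          XsB K t τ s = ∫ v, (∏ i : Fin (m K τ), (pol K τ i).fac (smallInd (uB K τ i v) (s i))) * RB K t τ v ∂(μ K τ)) ∧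
        -- the carriers ARE the normalised threshold averages
        (∀ K t, |t| ≤ S.l₀ → ∀ τ ∈ S.T K, S.A K t τ =
          (∏ i : Fin (m K τ), (κ (slot K τ i).1 * θ K τ i))⁻¹ *
            ∫ s, XsA K t τ s ∂(Measure.pi fun i : Fin (m K τ) =>
              volume.restrict (Icc ((1 - κ (slot K τ i).1) * θ K τ i) (θ K τ i)))) ∧
        (∀ K t, |t| ≤ S.l₀ → ∀ τ ∈ S.T K, S.B K t τ =
          (∏ i : Fin (m K τ), (κ (slot K τ i).1 * θ K τ i))⁻¹ *
            ∫ s, XsB K t τ s ∂(Measure.pi fun i : Fin (m K τ) =>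
              volume.restrict (Icc ((1 - κ (slot K τ i).1) * θ K τ i) (θ K τ i)))) ∧
        -- (O-mix-2) N16 and N20 in-edges, the width, the pinned shell parts, the record weight
        SupClose S.T μ m slot θ uA uB ρ ∧
        SiblingSuppression S.l₀ S.T S.A Nw n (sibW (fun a => linProfile (κ a)) κ μ m slot pol θ uA RA ρ) Ssup ∧
        SiblingSuppression S.l₀ S.T S.B Nw n (sibW (fun a => linProfile (κ a)) κ μ m slot pol θ uB RB ρ) Ssup ∧
        (∀ a ≤ Nw, 0 ≤ Ssup a) ∧ (∀ j, 0 ≤ ρ j) ∧ Summable ρ ∧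
        S.shA = shellW (fun a => linProfile (κ a)) μ m slot pol θ uA uB RA ∧
        S.shB = shellW (fun a => linProfile (κ a)) μ m slot pol θ uB uA RB ∧
        (∀ K, ∑ a ∈ Finset.range (Nw + 1), (n a : ℝ) * lipWeight (fun a => (κ a)⁻¹) Ssup ρ a K ≤ S.Wsh K) ∧ Summable S.Wsh) :
    S_N21 SRec := by
  intro F D g₀ os S hS
  obtain ⟨Ω, mΩ, μ, sf, κ, Nw, n, m, slot, pol, θ, uA, uB, RA, RB, XsA, XsB, ρ, Ssup, hκ, thr_pos, slot_mem, slot_band, meas,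
    remA_nonneg, remA_int, remB_nonneg, remB_int, hXsA, hXsB, hA, hB, hF, hSA, hSB, hS0, hρ0, hρ, hshA, hshB, hWsh, hsum⟩ :=
    hread F D g₀ os S hS
  exact n21_knit_sharpMixture XsA XsB hκ thr_pos slot_mem slot_band meas remA_nonneg remA_int remB_nonneg remB_int hXsA hXsB hA
    hB hF hSA hSB hS0 hρ0 hρ hshA hshB hWsh hsum

end AtCarriers

/-! ## §3 Vacuity guard: pv07's §5 toy IS a sharp mixture, so the reading of §2 is INHABITED non-degenerately and `S_N21` FIRES on it -/

section NonVacuity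

open T4LipschitzLedger.Sanity

/-- the toy's profiles ARE `linProfile ∘ κ` and its Lipschitz constants ARE `κ⁻¹` (definitional). [folklore] -/
theorem toy_profiles_eq : (χ = fun a => linProfile (κ a)) ∧ (Lχ = fun a => (κ a)⁻¹) := ⟨rfl, rfl⟩

/-- THE ONE-FACTOR MIXTURE IDENTITY behind the toy: the normalised average of the sharp indicator `1[u < s]` over `s ∈ [1∕2, 1]` is the
profile value `linProfile (1∕2) u` — file 5a's `sharpMixture_prod_eq_profile_prod` at `m = 1`, `κ = 1∕2`, `θ = 1`. [folklore] -/
theorem toy_mixture_eq (u : ℝ) :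
    (1 / 2 : ℝ)⁻¹ * ∫ s : Fin 1 → ℝ, smallInd u (s 0) ∂(Measure.pi fun _ : Fin 1 => volume.restrict (Icc (1 - (1 / 2 : ℝ)) 1)) =
      linProfile (1 / 2) (u / 1) := by
  have h := sharpMixture_prod_eq_profile_prod (m := 1) (fun _ => Pol.small) (fun _ => (1 / 2 : ℝ)) (fun _ => (1 : ℝ)) (fun _ => u)
    (fun _ => by norm_num) (fun _ => by norm_num)
  simp only [Fin.prod_univ_one, Pol.fac_small, mul_one] at h
  rw [h]
  ring

/-- run A's toy weight `1∕2` IS the normalised threshold average of its sharp weight (`u^A = 3∕4`: `2·|(3∕4, 1]| = 1∕2`), in the letters of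
§2's package at the toy data. [folklore] -/
theorem toy_A_eq_mixture (K : ℕ) (t : ℝ) :
    A K t () = (∏ i : Fin (m K ()), (κ (slot K () i).1 * θ K () i))⁻¹ *
      ∫ s, (∫ v, (∏ i : Fin (m K ()), (pol K () i).fac (smallInd (uA K () i v) (s i))) * R K t () v ∂(μ K ()))
        ∂(Measure.pi fun i : Fin (m K ()) => volume.restrict (Icc ((1 - κ (slot K () i).1) * θ K () i) (θ K () i))) := by
  show (1 / 2 : ℝ) = (∏ _i : Fin 1, ((1 / 2 : ℝ) * 1))⁻¹ *
      ∫ s : Fin 1 → ℝ, (∫ _v : Unit, (∏ i : Fin 1, Pol.small.fac (smallInd ((3 : ℝ) / 4) (s i))) * (1 : ℝ) ∂(Measure.dirac ()))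
        ∂(Measure.pi fun _ : Fin 1 => volume.restrict (Icc ((1 - (1 / 2 : ℝ)) * 1) 1))
  simp only [integral_dirac, mul_one, Fin.prod_univ_one, Pol.fac_small]
  rw [toy_mixture_eq, profile_A]

/-- run B's toy weight `1∕2 − (1∕2)^K∕4` IS the normalised threshold average of its sharp weight (`u^B = 3∕4 + (1∕2)^K∕8`). [folklore] -/
theorem toy_B_eq_mixture (K : ℕ) (t : ℝ) :
    B K t () = (∏ i : Fin (m K ()), (κ (slot K () i).1 * θ K () i))⁻¹ *
      ∫ s, (∫ v, (∏ i : Fin (m K ()), (pol K () i).fac (smallInd (uB K () i v) (s i))) * R K t () v ∂(μ K ()))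
        ∂(Measure.pi fun i : Fin (m K ()) => volume.restrict (Icc ((1 - κ (slot K () i).1) * θ K () i) (θ K () i))) := by
  show (1 / 2 : ℝ) - (1 / 2 : ℝ) ^ K / 4 = (∏ _i : Fin 1, ((1 / 2 : ℝ) * 1))⁻¹ *
      ∫ s : Fin 1 → ℝ, (∫ _v : Unit, (∏ i : Fin 1, Pol.small.fac (smallInd ((3 : ℝ) / 4 + (1 / 2 : ℝ) ^ K / 8) (s i))) * (1 : ℝ)
          ∂(Measure.dirac ()))
        ∂(Measure.pi fun _ : Fin 1 => volume.restrict (Icc ((1 - (1 / 2 : ℝ)) * 1) 1))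
  simp only [integral_dirac, mul_one, Fin.prod_univ_one, Pol.fac_small]
  rw [toy_mixture_eq, profile_B]

/-- **THE THRESHOLD-MIXTURE READING IS INHABITED AND `S_N21` FIRES ON IT.**  There is a carrier predicate `SRec` over `SU(2)` data such that
(i) `SRec` is a THRESHOLD-MIXTURE READING predicate — every bundle it pins carries EXACTLY the package of §2's `s_N21_of_sharpMixtureReading`;
(ii) it is INHABITED: pv07's §5 toy (`T4LipschitzLedger.Sanity`: one term per cutoff, a point space with the Dirac mass, one small-field factor of
age `0` and width `κ = 1∕2` at threshold `1`, run A testing `3∕4`, run B `3∕4 + (1∕2)^K∕8`, remainder `1`) with the two runs' weights `1∕2`,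
`1∕2 − (1∕2)^K∕4` — which ARE the normalised threshold averages of the sharp weights `1[u < s]` (`toy_A_eq_mixture`, `toy_B_eq_mixture`) —, `supClose`
with the summable width `(1∕2)^j∕8`, `siblingSuppression_A∕_B` with `S ≡ 4`; the bundle has nonempty classes, positive weights, run A's realized shell
part `(1∕2)^K∕4 > 0`, nonnegative run-B shell part and positive record weight `S.Wsh K = (1∕2)^K`; (iii) `S_N21 SRec` holds (by §2).  A toy, NOT
Bałaban's terms. [folklore] -/
theorem s_N21_fires_on_sharpMixtureReading :
    ∃ SRec : SpineRecordPred 2,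
      (∀ (F : T4Continuum.T4Family) (D : YMDAG.UVSplit.Datum F 2) (g₀ : ℕ → ℝ) (os : List (T4Continuum.ULoop F))
          (S : SpineCarriers), SRec F D g₀ os S →
        ∃ (Ω : ℕ → S.ι → Type) (_mΩ : ∀ K τ, MeasurableSpace (Ω K τ)) (μ : (K : ℕ) → (τ : S.ι) → Measure (Ω K τ))
          (_sf : ∀ K τ, SFinite (μ K τ)) (κ : ℕ → ℝ) (Nw : ℕ) (n : ℕ → ℕ) (m : ℕ → S.ι → ℕ) (slot : ℕ → S.ι → ℕ → Σ _ : ℕ, ℕ)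
          (pol : ℕ → S.ι → ℕ → Pol) (θ : ℕ → S.ι → ℕ → ℝ) (uA uB : (K : ℕ) → (τ : S.ι) → ℕ → Ω K τ → ℝ)
          (RA RB : (K : ℕ) → ℝ → (τ : S.ι) → Ω K τ → ℝ) (XsA XsB : (K : ℕ) → ℝ → (τ : S.ι) → (Fin (m K τ) → ℝ) → ℝ)
          (ρ Ssup : ℕ → ℝ),
          (∀ a, 0 < κ a ∧ κ a < 1) ∧
          (∀ K, ∀ τ ∈ S.T K, ∀ i < m K τ, 0 < θ K τ i) ∧
          (∀ K, ∀ τ ∈ S.T K, ∀ i < m K τ, slot K τ i ∈ (Finset.range (Nw + 1)).sigma fun a => Finset.range (n a)) ∧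
          (∀ K, ∀ τ ∈ S.T K, ∀ i < m K τ, (slot K τ i).1 ≤ K) ∧
          (∀ K, ∀ τ ∈ S.T K, ∀ i < m K τ, Measurable (uA K τ i) ∧ Measurable (uB K τ i)) ∧
          (∀ K t, |t| ≤ S.l₀ → ∀ τ ∈ S.T K, 0 ≤ᵐ[μ K τ] RA K t τ) ∧
          (∀ K t, |t| ≤ S.l₀ → ∀ τ ∈ S.T K, Integrable (RA K t τ) (μ K τ)) ∧
          (∀ K t, |t| ≤ S.l₀ → ∀ τ ∈ S.T K, 0 ≤ᵐ[μ K τ] RB K t τ) ∧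
          (∀ K t, |t| ≤ S.l₀ → ∀ τ ∈ S.T K, Integrable (RB K t τ) (μ K τ)) ∧
          (∀ K t, |t| ≤ S.l₀ → ∀ τ ∈ S.T K, ∀ s : Fin (m K τ) → ℝ,
            XsA K t τ s = ∫ v, (∏ i : Fin (m K τ), (pol K τ i).fac (smallInd (uA K τ i v) (s i))) * RA K t τ v ∂(μ K τ)) ∧
          (∀ K t, |t| ≤ S.l₀ → ∀ τ ∈ S.T K, ∀ s : Fin (m K τ) → ℝ,
            XsB K t τ s = ∫ v, (∏ i : Fin (m K τ), (pol K τ i).fac (smallInd (uB K τ i v) (s i))) * RB K t τ v ∂(μ K τ)) ∧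
          (∀ K t, |t| ≤ S.l₀ → ∀ τ ∈ S.T K, S.A K t τ =
            (∏ i : Fin (m K τ), (κ (slot K τ i).1 * θ K τ i))⁻¹ *
              ∫ s, XsA K t τ s ∂(Measure.pi fun i : Fin (m K τ) =>
                volume.restrict (Icc ((1 - κ (slot K τ i).1) * θ K τ i) (θ K τ i)))) ∧
          (∀ K t, |t| ≤ S.l₀ → ∀ τ ∈ S.T K, S.B K t τ =
            (∏ i : Fin (m K τ), (κ (slot K τ i).1 * θ K τ i))⁻¹ *
              ∫ s, XsB K t τ s ∂(Measure.pi fun i : Fin (m K τ) =>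
                volume.restrict (Icc ((1 - κ (slot K τ i).1) * θ K τ i) (θ K τ i)))) ∧
          SupClose S.T μ m slot θ uA uB ρ ∧
          SiblingSuppression S.l₀ S.T S.A Nw n (sibW (fun a => linProfile (κ a)) κ μ m slot pol θ uA RA ρ) Ssup ∧
          SiblingSuppression S.l₀ S.T S.B Nw n (sibW (fun a => linProfile (κ a)) κ μ m slot pol θ uB RB ρ) Ssup ∧
          (∀ a ≤ Nw, 0 ≤ Ssup a) ∧ (∀ j, 0 ≤ ρ j) ∧ Summable ρ ∧
          S.shA = shellW (fun a => linProfile (κ a)) μ m slot pol θ uA uB RA ∧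
          S.shB = shellW (fun a => linProfile (κ a)) μ m slot pol θ uB uA RB ∧
          (∀ K, ∑ a ∈ Finset.range (Nw + 1), (n a : ℝ) * lipWeight (fun a => (κ a)⁻¹) Ssup ρ a K ≤ S.Wsh K) ∧ Summable S.Wsh) ∧
      (∃ (F : T4Continuum.T4Family) (D : YMDAG.UVSplit.Datum F 2) (g₀ : ℕ → ℝ) (os : List (T4Continuum.ULoop F))
          (S : SpineCarriers), SRec F D g₀ os S ∧ (∀ K, (S.T K).Nonempty) ∧
          (∀ K t τ, 0 < S.A K t τ ∧ 0 < S.B K t τ ∧ 0 < S.shA K t τ ∧ 0 ≤ S.shB K t τ) ∧ ∀ K, 0 < S.Wsh K) ∧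
      S_N21 SRec := by
  obtain ⟨F, ⟨Dat⟩⟩ := N21AtSpineCarriers.exists_family_and_datum
  have hsumW : Summable fun K : ℕ => (1 / 2 : ℝ) ^ K := summable_geometric_of_lt_one (by norm_num) (by norm_num)
  refine ⟨_, fun _ _ _ _ _ h => h, ?_, s_N21_of_sharpMixtureReading _ fun _ _ _ _ _ h => h⟩
  refine ⟨F, Dat, fun _ => 0, [],
    { ι := Unit, l₀ := 1, vol := 1, K₀ := 0, T := T, A := A, B := B,
      shA := shellW χ μ m slot pol θ uA uB R, shB := shellW χ μ m slot pol θ uB uA R, Bad := fun _ _ => ∅,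
      W := fun _ => 0, Wsh := fun K => (1 / 2 : ℝ) ^ K, δ := fun _ => 0 }, ?_, ?_, ?_, ?_⟩
  · refine ⟨Ω, inferInstance, μ, fun _ _ => inferInstance, κ, 0, n, m, slot, pol, θ, uA, uB, R, R,
      fun K t _ s => ∫ v, (∏ i : Fin (m K ()), (pol K () i).fac (smallInd (uA K () i v) (s i))) * R K t () v ∂(μ K ()),
      fun K t _ s => ∫ v, (∏ i : Fin (m K ()), (pol K () i).fac (smallInd (uB K () i v) (s i))) * R K t () v ∂(μ K ()),
      ρ, S, fun _ => by norm_num [κ], termRepr_A.thr_pos, termRepr_A.slot_mem, termRepr_A.slot_band, termRepr_A.meas,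
      termRepr_A.rem_nonneg, termRepr_A.rem_int, termRepr_B.rem_nonneg, termRepr_B.rem_int,
      fun K t _ τ _ s => by obtain ⟨⟩ := τ; rfl, fun K t _ τ _ s => by obtain ⟨⟩ := τ; rfl,
      fun K t _ τ _ => by obtain ⟨⟩ := τ; exact toy_A_eq_mixture K t, fun K t _ τ _ => by obtain ⟨⟩ := τ; exact toy_B_eq_mixture K t,
      supClose, siblingSuppression_A, siblingSuppression_B, fun _ _ => by norm_num [S],
      fun j => by change (0 : ℝ) ≤ (1 / 2 : ℝ) ^ j / 8; positivity, summable_ρ, rfl, rfl, fun K => (bandWeight K).le, hsumW⟩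
  · intro K; exact ⟨(), by simp [T]⟩
  · intro K t τ
    obtain ⟨⟩ := τ
    have e : shellW χ μ m slot pol θ uB uA R K t () = shellW χ μ m slot pol θ uB uA R K 0 () := rfl
    refine ⟨by norm_num [A], ?_, shellW_A_pos K t, ?_⟩
    · have h1 := half_pow_le_one K
      simp only [B]
      linarith
    · show 0 ≤ shellW χ μ m slot pol θ uB uA R K t ()
      rw [e]
      exact termRepr_B.shellW_nonneg K 0 (by simp) () (by simp [T])
  · intro K; exact half_pow_pos K

end NonVacuity

end Summit.QuantumFields.YangMills.Theorems.N21AtSpineCarriersMixture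

end
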